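import Summits.ResolutionOfSingularities.ResolutionOfSingularities.Theorems.HilbertSamuelEliminationSigmaMaxModificationsCorridor3WLadderIsoTailsFormalFrameTowerStep
import HarnessLib

/-!
# [OURS · L1 W4.2 · D14 «K1 FREE-RATIONAL TAILS»] G1a-2 (ring-level ALTERNATIVE socket), part 2/2: the FRAME TOWER ASSEMBLY — the
# ℕ-recursion and the osculating arc of a free-rational tail (the socket OF RECORD is res-D-pv-010's scheme-level
# `…IsoTailsFormalFrameAssemblyStep` / `…FormalFrameAssembly`, lead-1 WORD 12:02:43Z; this ring-level twin is kept as an independent check) (crux `SigmaMaxModifications` stmt-ResolutionOfSingularities-18506 / conjunct stmt-…-19249; kernel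
# `IsoQuadraticTowerTerminates p 3`, card C5 K1; res-L1-w42-plan-1 RULING v3.14-14 (DN) «001 := G1a-2 TOWER ASSEMBLY», res-L1-w42-lead-1 WORD 11:22:38Z)

Prover res-type-001 (gen 8) on res-L1-w42-lead-1's CUT G1a (2026-08-27T10:43:09Z), piece (G1a-2), over the inputs in tree: lead-1's
`…IsoTailsFormalFrameStep` / `…IsoTailsFormalFrameTower` (p523847 / p524558: `stepFrame`, `stepPrime`, `mem_pow_of_frameTower`, point-matching
lemmas), res-type-038's `…IsoTailsFormalFrameBase` (p525909: the base frame `ψ₀`), and part 1/2 `…IsoTailsFormalFrameTowerStep` (point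
matching + ONE STEP `exists_stepFrame_of_tower`). Helper file `--supports stmt-ResolutionOfSingularities-19249 --as helper`; kernel only, no definitions, no named fact.
OURS (cell res-hironaka, slot W4.2); NOT statements of [Hironaka2017] nor of [CossartJannsenSaito2020] / [CossartPiltant2009]. AI-written; AI review
is weaker than expert review.

## The object (ring-level, so that the scheme tower of res-type-071's H4/H5 instantiates it)

A FREE-RATIONAL CHART TOWER: local rings `R n`, generators `x n = (t_n, x_{n,1}, x_{n,2}, x_{n,3})` of `𝔪_{R n}` (`t_n := x n 0`), lifts `ã n`,
and for every `n` the next ring `R (n+1)` = a localisation of `R_n[𝔪/t_n]` (tree `blowupAlgebra (maximalIdeal (R n)) (x n 0)`) at a prime `𝔑 n`, an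
`R n`-algebra through the blow-up algebra, with `t_{n+1} = t_n` (the SAME exceptional equation: non-satellite steps) and new coordinates
`x_{n+1,i} · t = x_{n,i} − ã_{n,i} t` (rational steps; `t` a non-zero-divisor of `R (n+1)`) — the output shape of res-type-071's
`exists_origin_presentation` / `exists_maximalIdeal_presentation` (`𝔪_{R′} = (t/1, (c̃_k/t)/1)`, `c̃_k = c_k − ã_k t`).

* **`exists_ringFrameTower`** — the ℕ-RECURSION (a `Nat.rec` on the subtype of frames carrying the invariants, choices by `Classical.choose`; no
  definition): from the BASE FRAME `ψ₀` of 038's `exists_baseFrame_of_rsop(_of_charP)` (local, `ψ₀ (x 0 i) = X i`, residue-surjective), frames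
  `ψ n` and constants `c` with `ψ 0 = ψ₀`, `ψ n t_n = X 0` and `ψ (n+1) ∘ (R n → R (n+1)) = (y ↦ t y + c_{n+1} t) ∘ ψ n` — VERBATIM the hypotheses
  `hcomm`, `ht` of lead-1's `mem_pow_of_frameTower`.
* **`mem_pow_arcIdeal_of_ringTower`** — with strict transforms `h_n ↦ t^m · h_{n+1}`: `∃ c, ψ₀ (h 0) ∈ (X 1 − tSeries c₁, X 2 − tSeries c₂,
  X 3 − tSeries c₃)^m` = the hypothesis `hhP` of res-type-001's `IsoTailsHS.not_isIsolatedInHSMaxLocus_adicCompletion_of_frameTowerArc` (p525298) and of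
  lead-1's `FormalFrame.not_isIsolatedInHSMaxLocus_of_frameTower` (p526668) minus `hord`; H∞-FINAL (res-D-pv-010) instantiates the tower from the scheme
  side and contradicts H8 (p526213).

References: U. Görtz, T. Wedhorn, *Algebraic Geometry I* (2nd ed. 2020), (13.19) p. 415 [GortzWedhorn2020]; V. Cossart, O. Piltant, J. Algebra 320
(2008), proof of Lemma 4.3 (3) (origin of the shifted chart) [CossartPiltant2008] and J. Algebra 321 (2009) ch. 3 I.9 (formal arc along point blow-ups)
[CossartPiltant2009]; idea-1 card C5.
-/

noncomputable section

set_option linter.dupNamespace false -- mandated namespace of this single-conjunct summit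

open MvPowerSeries IsLocalRing
open Literature.AlgebraicGeometry.Resolution

namespace Summit.ResolutionOfSingularities.ResolutionOfSingularities.Cruxes.SigmaMaxModifications.IdeasL1C5

universe u

namespace FormalFrame

variable {κ : Type u} [Field κ]

/-! ### The ℕ-recursion and the osculating arc -/

/-- **THE FRAME TOWER.** Along a free-rational chart tower (module docstring) with base frame `ψ₀`, there are local frames
`ψ n : R n → κ⟦X⟧`, `ψ 0 = ψ₀`, `ψ n t_n = X 0`, and constants `c` with `ψ (n+1) ∘ (R n → R (n+1)) = (y ↦ t y + c_{n+1} t) ∘ ψ n`.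
Recursion on `exists_stepFrame_of_tower`; the invariants «residue-surjective» and «`ψ n x_{n,i} ≡ X i + λ X 0 (mod 𝔪²)`» are
carried along. [OURS · L1 W4.2; AI-written] [cite: GortzWedhorn2020, (13.19) p. 415] -/
theorem exists_ringFrameTower (R : ℕ → Type u) [∀ n, CommRing (R n)] [∀ n, IsLocalRing (R n)]
    (x : ∀ n, Fin 4 → R n) (hx : ∀ n, Ideal.span (Set.range (x n)) = maximalIdeal (R n)) (at_ : ∀ n, Fin 4 → R n)
    [∀ n, Algebra (R n) (R (n + 1))] [∀ n, Algebra (blowupAlgebra (maximalIdeal (R n)) (x n 0)) (R (n + 1))]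
    [∀ n, IsScalarTower (R n) (blowupAlgebra (maximalIdeal (R n)) (x n 0)) (R (n + 1))]
    (𝔑 : ∀ n, Ideal (blowupAlgebra (maximalIdeal (R n)) (x n 0))) [∀ n, (𝔑 n).IsPrime]
    [∀ n, IsLocalization.AtPrime (R (n + 1)) (𝔑 n)]
    (ht : ∀ n, algebraMap (R n) (R (n + 1)) (x n 0) = x (n + 1) 0)
    (hr : ∀ n i, i ≠ 0 → x (n + 1) i * x (n + 1) 0 =
      algebraMap (R n) (R (n + 1)) (x n i) - algebraMap (R n) (R (n + 1)) (at_ n i) * x (n + 1) 0)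
    (hnz : ∀ n, x (n + 1) 0 ∈ nonZeroDivisors (R (n + 1)))
    (ψ₀ : R 0 →+* MvPowerSeries (Fin 4) κ) (hψ₀l : IsLocalHom ψ₀) (hψ₀x : ∀ i, ψ₀ (x 0 i) = X i)
    (hψ₀s : ∀ a : κ, ∃ r : R 0, ψ₀ r - C a ∈ maximalIdeal (MvPowerSeries (Fin 4) κ)) :
    ∃ (ψ : ∀ n, R n →+* MvPowerSeries (Fin 4) κ) (c : ℕ → Fin 4 → κ),
      ψ 0 = ψ₀ ∧ (∀ n, IsLocalHom (ψ n)) ∧ (∀ n, ψ n (x n 0) = X 0) ∧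
      ∀ n (r : R n), ψ (n + 1) (algebraMap (R n) (R (n + 1)) r) = subst (Series.transChartSubst (c (n + 1))) (ψ n r) := by
  -- the invariant carried along the tower
  let Good : ∀ n, (R n →+* MvPowerSeries (Fin 4) κ) → Prop := fun n φ =>
    IsLocalHom φ ∧ φ (x n 0) = X 0 ∧ (∀ a : κ, ∃ r : R n, φ r - C a ∈ maximalIdeal (MvPowerSeries (Fin 4) κ)) ∧
      ∃ lam : Fin 4 → κ, ∀ i, i ≠ 0 → φ (x n i) - X i - C (lam i) * X 0 ∈ maximalIdeal (MvPowerSeries (Fin 4) κ) ^ 2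
  have good0 : Good 0 ψ₀ := by
    refine ⟨hψ₀l, hψ₀x 0, hψ₀s, fun _ => 0, fun i _ => ?_⟩
    rw [hψ₀x i, map_zero, zero_mul, sub_zero, sub_self]
    exact zero_mem _
  -- one step
  have step : ∀ n (φ : R n →+* MvPowerSeries (Fin 4) κ), Good n φ →
      ∃ (φ' : R (n + 1) →+* MvPowerSeries (Fin 4) κ) (c : Fin 4 → κ),
        Good (n + 1) φ' ∧ ∀ r : R n, φ' (algebraMap (R n) (R (n + 1)) r) = subst (Series.transChartSubst c) (φ r) := by
    intro n φ hφ
    obtain ⟨hl, hφt, hφs, hφr⟩ := hφ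
    obtain ⟨φ', c, h1, h2, h3, h4, h5⟩ := exists_stepFrame_of_tower (x n) (hx n) (at_ n) φ hl hφt hφs hφr (R (n + 1)) (𝔑 n)
      (x (n + 1)) (hx (n + 1)) (ht n) (hr n) (hnz n)
    exact ⟨φ', c, ⟨h1, h2, h3, h4⟩, h5⟩
  -- the recursion
  let F : ∀ n, {φ : R n →+* MvPowerSeries (Fin 4) κ // Good n φ} := fun n =>
    Nat.rec (motive := fun n => {φ : R n →+* MvPowerSeries (Fin 4) κ // Good n φ}) ⟨ψ₀, good0⟩
      (fun n Fn => ⟨Classical.choose (step n Fn.1 Fn.2),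
        (Classical.choose_spec (Classical.choose_spec (step n Fn.1 Fn.2))).1⟩) n
  let c : ℕ → Fin 4 → κ := fun n =>
    Nat.rec (motive := fun _ => Fin 4 → κ) (fun _ => 0)
      (fun n _ => Classical.choose (Classical.choose_spec (step n (F n).1 (F n).2))) n
  refine ⟨fun n => (F n).1, c, rfl, fun n => (F n).2.1, fun n => (F n).2.2.1, fun n r => ?_⟩
  exact (Classical.choose_spec (Classical.choose_spec (step n (F n).1 (F n).2))).2 r

/-- **THE OSCULATING ARC OF A FREE-RATIONAL TAIL.** In the frame tower, if `h n ∈ R n` are strict transforms of multiplicity `m`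
(`h_n ↦ t^m · h_{n+1}` under `R n → R (n+1)`), then for some constants `c` the base image `ψ₀ (h 0)` lies in
`(X 1 − Σ_k c_{k,1} t^k, X 2 − Σ_k c_{k,2} t^k, X 3 − Σ_k c_{k,3} t^k)^m ⊆ κ⟦t, y⟧` (lead-1's `mem_pow_of_frameTower` on
`exists_ringFrameTower`) — the hypothesis `hhP` of `IsoTailsHS.not_isIsolatedInHSMaxLocus_adicCompletion_of_frameTowerArc` (p525298).
[OURS · L1 W4.2; AI-written] [cite: CossartPiltant2009, ch. 3 I.9] -/
theorem mem_pow_arcIdeal_of_ringTower (R : ℕ → Type u) [∀ n, CommRing (R n)] [∀ n, IsLocalRing (R n)]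
    (x : ∀ n, Fin 4 → R n) (hx : ∀ n, Ideal.span (Set.range (x n)) = maximalIdeal (R n)) (at_ : ∀ n, Fin 4 → R n)
    [∀ n, Algebra (R n) (R (n + 1))] [∀ n, Algebra (blowupAlgebra (maximalIdeal (R n)) (x n 0)) (R (n + 1))]
    [∀ n, IsScalarTower (R n) (blowupAlgebra (maximalIdeal (R n)) (x n 0)) (R (n + 1))]
    (𝔑 : ∀ n, Ideal (blowupAlgebra (maximalIdeal (R n)) (x n 0))) [∀ n, (𝔑 n).IsPrime]
    [∀ n, IsLocalization.AtPrime (R (n + 1)) (𝔑 n)]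
    (ht : ∀ n, algebraMap (R n) (R (n + 1)) (x n 0) = x (n + 1) 0)
    (hr : ∀ n i, i ≠ 0 → x (n + 1) i * x (n + 1) 0 =
      algebraMap (R n) (R (n + 1)) (x n i) - algebraMap (R n) (R (n + 1)) (at_ n i) * x (n + 1) 0)
    (hnz : ∀ n, x (n + 1) 0 ∈ nonZeroDivisors (R (n + 1)))
    (ψ₀ : R 0 →+* MvPowerSeries (Fin 4) κ) (hψ₀l : IsLocalHom ψ₀) (hψ₀x : ∀ i, ψ₀ (x 0 i) = X i)
    (hψ₀s : ∀ a : κ, ∃ r : R 0, ψ₀ r - C a ∈ maximalIdeal (MvPowerSeries (Fin 4) κ))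
    (h : ∀ n, R n) (m : ℕ) (hstrict : ∀ n, algebraMap (R n) (R (n + 1)) (h n) = x (n + 1) 0 ^ m * h (n + 1)) :
    ∃ c : ℕ → Fin 4 → κ, ψ₀ (h 0) ∈ (Ideal.span ({X 1 - Series.tSeries (fun k => c k 1), X 2 - Series.tSeries (fun k => c k 2),
      X 3 - Series.tSeries (fun k => c k 3)} : Set (MvPowerSeries (Fin 4) κ))) ^ m := by
  obtain ⟨ψ, c, hψ0, -, hψt, hcomm⟩ :=
    exists_ringFrameTower R x hx at_ 𝔑 ht hr hnz ψ₀ hψ₀l hψ₀x hψ₀s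
  refine ⟨c, ?_⟩
  rw [← hψ0]
  exact mem_pow_of_frameTower (fun n => algebraMap (R n) (R (n + 1))) ψ c (fun n => x n 0) h m hcomm hψt hstrict

end FormalFrame

end Summit.ResolutionOfSingularities.ResolutionOfSingularities.Cruxes.SigmaMaxModifications.IdeasL1C5

end
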